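import Literature.MathematicalPhysics.QuantumFieldTheory.QCDTransferMatrix
import Literature.MathematicalPhysics.QuantumFieldTheory.WilsonTorusTransferMatrix
import Literature.Probability.LatticeModels.SixVertexTransferMatrix
import Summits.QuantumFields.QCD.Theorems.QuarksAsStableActionStableActionBridgeFermionSliceContinuous
import Summits.QuantumFields.QCD.Theorems.QuarksAsStableActionStableActionBridgeGaugeKernelBounds

/-!
# Stub `stub_cyclic_scalarise` of line `twisted_trace_transfer`
(crux `QuarksAsStableAction.StableActionBridge`, item stmt-QuantumFields-9737; sub-goal B5 of step E3)

The landed capstones of the F3 dictionary express the two torus denominators of lattice QCD — the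
thermal one (a TRACE) and the statement's time-periodic one (a SUPERTRACE `Σ_s (−1)^{#s} (·)_{ss}`) —
as integrals over all spatial slices `U_t` and temporal links `g_t`, `t : ℤ/N`, of
`∏_t K_β(U_t, U_{t+1}^{g_t}) · (S)Tr ∏_t [T̂_F(U_t) Γ(G_{g_t})]`.  Step E3 needs them as CYCLIC integrals
`∫ ∏_{t : Fin N} k(V t, V (t+1)) dρ^{⊗N}(V)` of ONE scalar kernel on `SU(3)^{E₃} × Finset(modes)`,
`ρ = Haar ⊗ count`, `k((U,s),(U',s')) = (R(U) B(U,U') R(U'))_{s s'}` with the Gauss-averaged bond kernel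
`B(U,U')_{a c} = ∫ K_β(U, U'^g) Γ(G_g)_{a c} dg` and `R(U)` any continuous pointwise square root of
`T̂_F(U)` commuting with the fermion parity: this is `stub_cyclic_scalarise` below.

Proof.  `N = n + 1`, `ZMod (n+1) = Fin (n+1)` definitionally, `(List.range N).map … = List.ofFn …`.
Algebra at fixed `(U, g)`: the weighted trace `Σ_s w_s (A₀⋯A_n)_{ss}` is the cyclic path sum
`Σ_p w(p₀) ∏_t (A_t)_{p_t p_{t+1}}` (the tree's `SixVertex.trace_listProd_ofFn_eq_sum_cyclic`), and by
cyclicity plus `[diag w, R(U₀)] = 0` the word `∏_t R_t R_t Γ_t` regroups as `∏_t R_t Γ_t R_{t+1}`.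
Each temporal link enters exactly one bond, so the Haar integral over `g` factorises
(`integral_fintype_prod_eq_prod`) into the entries `(R_t B_t R_{t+1})_{s_t s_{t+1}}`.  Measures: Fubini
over `(U, g)` on the left (continuous integrand, compact space); on the right the measurable equivalence
`(Fin N → X × F) ≃ (Fin N → X) × (Fin N → F)` (`measurePreserving_arrowProdEquivProdArrow`), Fubini, and
`pi count = count` on the finite path space; integrability of the right-hand integrand by writing it as
the `g`-integral of a continuous function (`Integrable.integral_prod_left`).  The analysis is done for
abstract compact slice/link spaces and instantiated at the end.  Pure theorem file; helpers in the
sub-namespace `StubCyclicScalarise`.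

References: M. Lüscher, Commun. Math. Phys. 54 (1977) 283 [Luscher1977, pp. 283–292]; I. Montvay, G. Münster,
*Quantum Fields on a Lattice* (CUP 1994) [MontvayMunster1994, §4.1.3 (4.34)]; J. Smit, *Introduction to
Quantum Fields on a Lattice* [Smit2023, §4.6 (4.127)–(4.137), §6.5 (6.87)–(6.91)].
-/

noncomputable section

namespace Summit.QuantumFields.QCD.Cruxes.StableActionBridge.TwistedTraceTransfer

open MeasureTheory
open scoped InnerProductSpace ComplexConjugate Matrix BigOperators
open Literature.MathematicalPhysics.QuantumFieldTheory Literature.MathematicalPhysics.QuantumLattice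
open Literature.Probability.LatticeModels (TorusSite)

namespace StubCyclicScalarise

/-! ### Generic helpers -/

/-- A continuous complex function on a compact space is integrable for every finite measure. [folklore] -/
theorem integrable_of_continuous {α : Type*} [TopologicalSpace α] [MeasurableSpace α]
    [OpensMeasurableSpace α] [CompactSpace α] {μ : Measure α} [IsFiniteMeasure μ] {f : α → ℂ}
    (hf : Continuous f) : Integrable f μ := by
  obtain ⟨C, hC⟩ := isCompact_univ.exists_bound_of_continuousOn hf.continuousOn
  exact (integrable_const C).mono' hf.aestronglyMeasurable_of_compactSpace
    (Filter.Eventually.of_forall fun x => hC x (Set.mem_univ x))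

/-- The integral against a finite product of counting measures on a finite type is the finite sum
(`Measure.pi count = count`: both give mass one to singletons). [folklore] -/
theorem integral_pi_count {ι G : Type*} [Fintype ι] [DecidableEq ι] [Fintype G] [MeasurableSpace G]
    [MeasurableSingletonClass G] (h : (ι → G) → ℂ) :
    ∫ s, h s ∂(Measure.pi fun _ : ι => (Measure.count : Measure G)) = ∑ s, h s := by
  have hpi : (Measure.pi fun _ : ι => (Measure.count : Measure G)) = Measure.count :=
    Measure.ext_iff_singleton.2 fun s => by simp only [Measure.pi_singleton, Measure.count_singleton, Finset.prod_const_one]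
  rw [hpi, integral_count]

/-- `(List.range (n+1)).map f` is the `List.ofFn` of `f ∘ Fin.val`. [folklore] -/
theorem range_map_eq_ofFn {M : Type*} (n : ℕ) (f : ℕ → M) :
    (List.range (n + 1)).map f = List.ofFn (fun t : Fin (n + 1) => f t.val) := by
  rw [List.ofFn_eq_pmap, List.pmap_eq_map]

/-- For `t : Fin (n+1) = ZMod (n+1)` the cast of `t.val` back to `ZMod (n+1)` is `t`. [folklore] -/
theorem natCast_zmod_fin (n : ℕ) (t : Fin (n + 1)) : ((t.val : ℕ) : ZMod (n + 1)) = t :=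
  ZMod.natCast_zmod_val (n := n + 1) t

/-! ### Algebra: weighted cyclic trace formula and cyclic regrouping -/

/-- Shift lemma for an open chain: `a₀ · ∏ᵢ (aᵢ yᵢ aᵢ₊₁) = ∏ᵢ (aᵢ aᵢ yᵢ) · a_m` (pure reassociation).
[folklore] -/
theorem mul_listProd_chain {M : Type*} [Monoid M] (m : ℕ) (a : Fin (m + 1) → M) (y : Fin m → M) :
    a 0 * (List.ofFn fun i : Fin m => a i.castSucc * y i * a i.succ).prod =
      (List.ofFn fun i : Fin m => a i.castSucc * a i.castSucc * y i).prod * a (Fin.last m) := by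
  induction m with
  | zero => simp
  | succ m ih =>
    have h := ih (fun j => a j.succ) (fun j => y j.succ)
    simp only [Fin.succ_zero_eq_one, Fin.succ_castSucc, Fin.succ_last, Nat.succ_eq_add_one] at h
    rw [List.ofFn_succ, List.ofFn_succ, List.prod_cons, List.prod_cons]
    simp only [Fin.castSucc_zero, Fin.succ_zero_eq_one]
    rw [show a 0 * (a 0 * y 0 * a 1 * (List.ofFn fun i : Fin m =>
        a i.succ.castSucc * y i.succ * a i.succ.succ).prod) = a 0 * a 0 * y 0 * (a 1 *
          (List.ofFn fun i : Fin m => a i.succ.castSucc * y i.succ * a i.succ.succ).prod) by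
      simp only [mul_assoc], h]
    simp only [mul_assoc]

variable {F : Type*} [Fintype F] [DecidableEq F]

/-- **Weighted cyclic trace formula**: `Σ_s w_s (A₀ ⋯ A_n)_{ss} = Σ_{p : Fin (n+1) → F} w(p₀) ∏_k A_k(p_k, p_{k+1})`
(indices mod `n + 1`; the tree's cyclic trace formula for the word with `diag w` in front). [folklore] -/
theorem sum_mul_listProd_apply_eq_sum_cyclic (n : ℕ) (w : F → ℂ) (A : Fin (n + 1) → Matrix F F ℂ) :
    ∑ s, w s * (List.ofFn A).prod s s =
      ∑ p : Fin (n + 1) → F, w (p 0) * ∏ k, A k (p k) (p (k + 1)) := by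
  have hprod : (List.ofFn (Fin.cons (Matrix.diagonal w * A 0) (fun i => A i.succ) :
      Fin (n + 1) → Matrix F F ℂ)).prod = Matrix.diagonal w * (List.ofFn A).prod := by
    rw [List.ofFn_succ, List.ofFn_succ, List.prod_cons, List.prod_cons, Fin.cons_zero,
      Matrix.mul_assoc]
    simp only [Fin.cons_succ]
  have htr : (List.ofFn (Fin.cons (Matrix.diagonal w * A 0) (fun i => A i.succ) :
      Fin (n + 1) → Matrix F F ℂ)).prod.trace = ∑ s, w s * (List.ofFn A).prod s s := by
    rw [hprod, Matrix.trace]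
    simp only [Matrix.diag_apply, Matrix.diagonal_mul]
  rw [← htr, Literature.Probability.LatticeModels.SixVertex.trace_listProd_ofFn_eq_sum_cyclic]
  refine Finset.sum_congr rfl fun p _ => ?_
  rw [Fin.prod_univ_succ, Fin.prod_univ_succ, Fin.cons_zero, Matrix.diagonal_mul, mul_assoc]
  simp only [Fin.cons_succ]

/-- **Cyclic regrouping**: if `diag w` commutes with `r₀` then
`Σ_s w_s (∏_t r_t r_t y_t)_{ss} = Σ_p w(p₀) ∏_t (r_t y_t r_{t+1})_{p_t p_{t+1}}`, i.e.
`Tr[D (r₀r₀y₀)(r₁r₁y₁)⋯] = Tr[D (r₀y₀r₁)⋯(r_n y_n r₀)]` by cyclicity. [cite: Luscher1977, pp. 283–292] -/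
theorem sum_cyclic_regroup (n : ℕ) (w : F → ℂ) (r y : Fin (n + 1) → Matrix F F ℂ)
    (hw : Matrix.diagonal w * r 0 = r 0 * Matrix.diagonal w) :
    ∑ s, w s * (List.ofFn fun t => r t * r t * y t).prod s s =
      ∑ p : Fin (n + 1) → F, w (p 0) * ∏ t, (r t * y t * r (t + 1)) (p t) (p (t + 1)) := by
  rw [← sum_mul_listProd_apply_eq_sum_cyclic]
  have key : ∀ L : Matrix F F ℂ, ∑ s, w s * L s s = (Matrix.diagonal w * L).trace := fun L => by
    rw [Matrix.trace]; simp only [Matrix.diag_apply, Matrix.diagonal_mul]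
  rw [key, key, List.ofFn_succ' (f := fun t => r t * r t * y t),
    List.ofFn_succ' (f := fun t => r t * y t * r (t + 1)), List.prod_concat, List.prod_concat]
  simp only [Fin.coeSucc_eq_succ, Fin.last_add_one]
  have hshift := mul_listProd_chain n r (fun i => y i.castSucc)
  symm
  calc (Matrix.diagonal w * ((List.ofFn fun i : Fin n => r i.castSucc * y i.castSucc * r i.succ).prod *
          (r (Fin.last n) * y (Fin.last n) * r 0))).trace
      = ((Matrix.diagonal w * ((List.ofFn fun i : Fin n => r i.castSucc * y i.castSucc * r i.succ).prod *
          (r (Fin.last n) * y (Fin.last n)))) * r 0).trace := by simp only [Matrix.mul_assoc]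
    _ = (r 0 * (Matrix.diagonal w * ((List.ofFn fun i : Fin n =>
          r i.castSucc * y i.castSucc * r i.succ).prod * (r (Fin.last n) * y (Fin.last n))))).trace :=
        Matrix.trace_mul_comm _ _
    _ = (Matrix.diagonal w * ((r 0 * (List.ofFn fun i : Fin n =>
          r i.castSucc * y i.castSucc * r i.succ).prod) * (r (Fin.last n) * y (Fin.last n)))).trace := by
        rw [← Matrix.mul_assoc (r 0), ← hw]; simp only [Matrix.mul_assoc]
    _ = _ := by rw [hshift]; simp only [Matrix.mul_assoc]

/-! ### Abstract slice data (`X` slices, `Gt` temporal links, `F` Fock indices, bond kernel `K`,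
action `act` of `Gt` on `X`, Fock rotation `Γ`, square root `R`, weight `w`): continuity, Fubini -/

section Abstract

variable {X Gt P : Type*} [TopologicalSpace X] [TopologicalSpace Gt] [TopologicalSpace P]
  (K : X → X → ℝ) (act : Gt → X → X) (Γ : Gt → Matrix F F ℂ) (R : X → Matrix F F ℂ) (w : F → ℂ)

omit [TopologicalSpace X] [TopologicalSpace Gt] in
/-- **Pointwise regrouping of the left-hand integrand** into the sum over index paths of the path
integrands (weighted cyclic trace formula, cyclicity, `[diag w, R] = 0`). [cite: Luscher1977, pp. 283–292] -/
theorem lhsIntegrand_eq_sum (n : ℕ) (hw : ∀ U, Matrix.diagonal w * R U = R U * Matrix.diagonal w)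
    (U : Fin (n + 1) → X) (g : Fin (n + 1) → Gt) :
    ((∏ t : Fin (n + 1), K (U t) (act (g t) (U (t + 1))) : ℝ) : ℂ) *
        ∑ s : F, w s * (List.ofFn fun t : Fin (n + 1) => R (U t) * R (U t) * Γ (g t)).prod s s =
      ∑ s : Fin (n + 1) → F, w (s 0) * ∏ t : Fin (n + 1),
        (((K (U t) (act (g t) (U (t + 1))) : ℝ) : ℂ) * (R (U t) * Γ (g t) * R (U (t + 1))) (s t) (s (t + 1))) := by
  rw [sum_cyclic_regroup n w (fun t => R (U t)) (fun t => Γ (g t)) (hw _), Complex.ofReal_prod,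
    Finset.mul_sum]
  refine Finset.sum_congr rfl fun s _ => ?_
  rw [Finset.prod_mul_distrib]
  ring

/-- `p ↦ act (f p) (h p)` is continuous for a jointly continuous action and continuous `f`, `h`. [folklore] -/
theorem continuous_act₂ (hact : Continuous fun q : Gt × X => act q.1 q.2) {f : P → Gt} {h : P → X}
    (hf : Continuous f) (hh : Continuous h) : Continuous fun p => act (f p) (h p) :=
  hact.comp' (hf.prodMk hh)

/-- `p ↦ (K (f p) (h p) : ℂ)` is continuous for a jointly continuous kernel and continuous `f`, `h`. [folklore] -/
theorem continuous_kernel₂ (hK : Continuous fun q : X × X => K q.1 q.2) {f h : P → X}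
    (hf : Continuous f) (hh : Continuous h) : Continuous fun p => ((K (f p) (h p) : ℝ) : ℂ) :=
  Complex.continuous_ofReal.comp' (hK.comp' (hf.prodMk hh))

/-- The left-hand integrand `∏_t K(U_t, U_{t+1}^{g_t}) · Σ_s w_s (∏_t R_t R_t Γ_t)_{ss}` is
continuous along any continuous family `p ↦ (U(p), g(p))` of slices and temporal links. [folklore] -/
theorem continuous_lhsIntegrand (n : ℕ) (hK : Continuous fun q : X × X => K q.1 q.2)
    (hact : Continuous fun q : Gt × X => act q.1 q.2) (hΓ : Continuous Γ) (hRc : Continuous R)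
    {u : P → Fin (n + 1) → X} {γ : P → Fin (n + 1) → Gt} (hu : Continuous u) (hγ : Continuous γ) :
    Continuous fun p => ((∏ t : Fin (n + 1), K (u p t) (act (γ p t) (u p (t + 1))) : ℝ) : ℂ) *
      ∑ s : F, w s * (List.ofFn fun t : Fin (n + 1) => R (u p t) * R (u p t) * Γ (γ p t)).prod s s := by
  have hut : ∀ t, Continuous fun p => u p t := fun t => (continuous_apply t).comp' hu
  have hγt : ∀ t, Continuous fun p => γ p t := fun t => (continuous_apply t).comp' hγ
  have hKc : Continuous fun p => ((∏ t : Fin (n + 1), K (u p t) (act (γ p t) (u p (t + 1))) : ℝ) : ℂ) := by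
    simp only [Complex.ofReal_prod]
    exact continuous_finsetProd _ fun t _ =>
      continuous_kernel₂ K hK (hut t) (continuous_act₂ act hact (hγt t) (hut (t + 1)))
  have hL : Continuous fun p => (List.ofFn fun t : Fin (n + 1) => R (u p t) * R (u p t) * Γ (γ p t)).prod := by
    simp only [List.ofFn_eq_map]
    exact continuous_list_prod _ fun t _ => ((hRc.comp' (hut t)).mul (hRc.comp' (hut t))).mul (hΓ.comp' (hγt t))
  exact hKc.mul (continuous_finsetSum _ fun s _ => continuous_const.mul (hL.matrix_elem s s))

omit [DecidableEq F] in
/-- The path integrand `w(s₀) ∏_t K(U_t, U_{t+1}^{g_t}) (R_t Γ_t R_{t+1})_{s_t s_{t+1}}` of a fixed index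
path `s` is continuous along any continuous family `p ↦ (U(p), g(p))`. [folklore] -/
theorem continuous_pathIntegrand (n : ℕ) (hK : Continuous fun q : X × X => K q.1 q.2)
    (hact : Continuous fun q : Gt × X => act q.1 q.2) (hΓ : Continuous Γ) (hRc : Continuous R)
    {u : P → Fin (n + 1) → X} {γ : P → Fin (n + 1) → Gt} (hu : Continuous u) (hγ : Continuous γ)
    (s : Fin (n + 1) → F) :
    Continuous fun p => w (s 0) * ∏ t : Fin (n + 1), (((K (u p t) (act (γ p t) (u p (t + 1))) : ℝ) : ℂ) *
      (R (u p t) * Γ (γ p t) * R (u p (t + 1))) (s t) (s (t + 1))) := by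
  have hut : ∀ t, Continuous fun p => u p t := fun t => (continuous_apply t).comp' hu
  have hγt : ∀ t, Continuous fun p => γ p t := fun t => (continuous_apply t).comp' hγ
  exact continuous_const.mul (continuous_finsetProd _ fun t _ =>
    (continuous_kernel₂ K hK (hut t) (continuous_act₂ act hact (hγt t) (hut (t + 1)))).mul
      ((((hRc.comp' (hut t)).mul (hΓ.comp' (hγt t))).mul (hRc.comp' (hut (t + 1)))).matrix_elem _ _))

variable [MeasurableSpace Gt] [OpensMeasurableSpace Gt] [CompactSpace Gt] [SecondCountableTopology Gt]
  (ν : Measure Gt) [IsFiniteMeasure ν]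

omit [DecidableEq F] [SecondCountableTopology Gt] in
/-- **Bond integral**: constant matrices come out of the entrywise average over the temporal links,
`∫ K'(g) (A Γ_g C)_{ab} dg = (A B C)_{ab}` with `B_{ac} = ∫ K'(g) (Γ_g)_{ac} dg`. [folklore] -/
theorem integral_mul_three_apply (hΓ : Continuous Γ) (K' : Gt → ℂ) (hK' : Continuous K')
    (A C : Matrix F F ℂ) (a b : F) :
    ∫ g, K' g * (A * Γ g * C) a b ∂ν = (A * (Matrix.of fun a c => ∫ g, K' g * Γ g a c ∂ν) * C) a b := by
  have hint : ∀ d c, Integrable (fun g => K' g * (A a d * Γ g d c * C c b)) ν := fun d c =>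
    integrable_of_continuous (hK'.mul ((continuous_const.mul (hΓ.matrix_elem d c)).mul continuous_const))
  simp only [Matrix.mul_apply, Matrix.of_apply, Finset.sum_mul, Finset.mul_sum]
  rw [integral_finsetSum _ fun c _ => integrable_finsetSum _ fun d _ => hint d c]
  refine Finset.sum_congr rfl fun c _ => ?_
  rw [integral_finsetSum _ fun d _ => hint d c]
  refine Finset.sum_congr rfl fun d _ => ?_
  rw [← integral_const_mul, ← integral_mul_const]
  refine integral_congr_ae (Filter.Eventually.of_forall fun g => ?_)
  ring

omit [DecidableEq F] in
/-- **The temporal-link integral of a path integrand factorises over the bonds**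
(`integral_fintype_prod_eq_prod`: each `g_t` enters exactly one bond) and yields
`w(s₀) ∏_t (R_t B_t R_{t+1})_{s_t s_{t+1}}` with the averaged bond kernel `B_t`. [cite: Luscher1977, pp. 283–292] -/
theorem integral_pathIntegrand (n : ℕ) (hK : Continuous fun q : X × X => K q.1 q.2)
    (hact : Continuous fun q : Gt × X => act q.1 q.2) (hΓ : Continuous Γ)
    (U : Fin (n + 1) → X) (s : Fin (n + 1) → F) :
    ∫ g : Fin (n + 1) → Gt, w (s 0) * ∏ t : Fin (n + 1), (((K (U t) (act (g t) (U (t + 1))) : ℝ) : ℂ) *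
        (R (U t) * Γ (g t) * R (U (t + 1))) (s t) (s (t + 1))) ∂(Measure.pi fun _ => ν) =
      w (s 0) * ∏ t : Fin (n + 1), (R (U t) *
        (Matrix.of fun a c => ∫ g, ((K (U t) (act g (U (t + 1))) : ℝ) : ℂ) * Γ g a c ∂ν) *
          R (U (t + 1))) (s t) (s (t + 1)) := by
  rw [integral_const_mul]
  congr 1
  have hprod := integral_fintype_prod_eq_prod (𝕜 := ℂ) (μ := fun _ : Fin (n + 1) => ν) fun (t : Fin (n + 1))
    (x : Gt) => (((K (U t) (act x (U (t + 1))) : ℝ) : ℂ) * (R (U t) * Γ x * R (U (t + 1))) (s t) (s (t + 1)))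
  rw [hprod]
  exact Finset.prod_congr rfl fun t _ => integral_mul_three_apply Γ ν hΓ _
    (continuous_kernel₂ K hK continuous_const (continuous_act₂ act hact continuous_id' continuous_const)) _ _ _ _

/-- **The temporal-link integral of the left-hand integrand at fixed slices** is the sum over index
paths of `w(s₀) ∏_t (R_t B_t R_{t+1})_{s_t s_{t+1}}`. [cite: Luscher1977, pp. 283–292] -/
theorem integral_lhsIntegrand (n : ℕ) (hK : Continuous fun q : X × X => K q.1 q.2)
    (hact : Continuous fun q : Gt × X => act q.1 q.2) (hΓ : Continuous Γ) (hRc : Continuous R)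
    (hw : ∀ U, Matrix.diagonal w * R U = R U * Matrix.diagonal w) (U : Fin (n + 1) → X) :
    ∫ g : Fin (n + 1) → Gt, ((∏ t : Fin (n + 1), K (U t) (act (g t) (U (t + 1))) : ℝ) : ℂ) *
        ∑ s : F, w s * (List.ofFn fun t : Fin (n + 1) => R (U t) * R (U t) * Γ (g t)).prod s s
      ∂(Measure.pi fun _ => ν) =
    ∑ s : Fin (n + 1) → F, w (s 0) * ∏ t : Fin (n + 1), (R (U t) *
      (Matrix.of fun a c => ∫ g, ((K (U t) (act g (U (t + 1))) : ℝ) : ℂ) * Γ g a c ∂ν) *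
        R (U (t + 1))) (s t) (s (t + 1)) := by
  simp_rw [lhsIntegrand_eq_sum K act Γ R w n hw U]
  rw [integral_finsetSum _ fun s _ => integrable_of_continuous
    (continuous_pathIntegrand (u := fun _ => U) (γ := fun g => g) K act Γ R w n hK hact hΓ hRc
      continuous_const continuous_id' s)]
  exact Finset.sum_congr rfl fun s _ => integral_pathIntegrand K act Γ R w ν n hK hact hΓ U s

variable [MeasurableSpace X] [OpensMeasurableSpace X] [CompactSpace X] [SecondCountableTopology X]
  (μ : Measure X) [IsFiniteMeasure μ] [MeasurableSpace F] [MeasurableSingletonClass F]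

omit [DecidableEq F] in
/-- **Integrability of the right-hand (cyclic) integrand** on `(slices) × (index paths)`: each section at
a fixed path is the temporal-link integral (`integral_pathIntegrand`) of a continuous function on a compact
space (`Integrable.integral_prod_left`), and the path space is finite. [folklore] -/
theorem integrable_rhsIntegrand (n : ℕ) (hK : Continuous fun q : X × X => K q.1 q.2)
    (hact : Continuous fun q : Gt × X => act q.1 q.2) (hΓ : Continuous Γ) (hRc : Continuous R) :
    Integrable (fun q : (Fin (n + 1) → X) × (Fin (n + 1) → F) =>
      w (q.2 0) * ∏ t : Fin (n + 1), (R (q.1 t) *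
        (Matrix.of fun a c => ∫ g, ((K (q.1 t) (act g (q.1 (t + 1))) : ℝ) : ℂ) * Γ g a c ∂ν) *
          R (q.1 (t + 1))) (q.2 t) (q.2 (t + 1)))
      ((Measure.pi fun _ : Fin (n + 1) => μ).prod (Measure.pi fun _ : Fin (n + 1) => (Measure.count : Measure F))) := by
  have hcont := fun s => continuous_pathIntegrand (P := (Fin (n + 1) → X) × (Fin (n + 1) → Gt))
    K act Γ R w n hK hact hΓ hRc continuous_fst continuous_snd s
  refine (integrable_prod_iff' ?_).2 ⟨Filter.Eventually.of_forall fun s => ?_, Integrable.of_finite⟩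
  · refine (measurable_from_prod_countable_left fun s => ?_).aestronglyMeasurable
    dsimp only
    simp_rw [← integral_pathIntegrand K act Γ R w ν n hK hact hΓ]
    exact ((hcont s).stronglyMeasurable.integral_prod_right'
      (ν := Measure.pi fun _ : Fin (n + 1) => ν)).measurable
  · simp_rw [← integral_pathIntegrand K act Γ R w ν n hK hact hΓ]
    exact (integrable_of_continuous (μ := (Measure.pi fun _ : Fin (n + 1) => μ).prod
      (Measure.pi fun _ : Fin (n + 1) => ν)) (hcont s)).integral_prod_left

/-- **The stub in abstract form, over `Fin (n+1)`, with a general diagonal weight `w`** (`w = 1`: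
trace; `w = (−1)^{#s}`: supertrace): both sides equal `∫ Σ_s w(s₀) ∏_t (R_t B_t R_{t+1})_{s_t s_{t+1}} dU`
(left: Fubini and `integral_lhsIntegrand`; right: `(Fin N → X × F) ≃ (Fin N → X) × (Fin N → F)`, Fubini,
`pi count = count`). [cite: Luscher1977, pp. 283–292] [cite: MontvayMunster1994, §4.1.3 (4.34)] -/
theorem main_fin (n : ℕ) (hK : Continuous fun q : X × X => K q.1 q.2)
    (hact : Continuous fun q : Gt × X => act q.1 q.2) (hΓ : Continuous Γ) (hRc : Continuous R)
    (hw : ∀ U, Matrix.diagonal w * R U = R U * Matrix.diagonal w) :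
    (∫ p : (Fin (n + 1) → X) × (Fin (n + 1) → Gt),
        ((∏ t : Fin (n + 1), K (p.1 t) (act (p.2 t) (p.1 (t + 1))) : ℝ) : ℂ) *
          ∑ s : F, w s * (List.ofFn fun t : Fin (n + 1) => R (p.1 t) * R (p.1 t) * Γ (p.2 t)).prod s s
        ∂((Measure.pi fun _ : Fin (n + 1) => μ).prod (Measure.pi fun _ : Fin (n + 1) => ν))) =
      ∫ V : Fin (n + 1) → X × F, w (V 0).2 * ∏ t : Fin (n + 1), (R (V t).1 *
          (Matrix.of fun a c => ∫ g, ((K (V t).1 (act g (V (t + 1)).1) : ℝ) : ℂ) * Γ g a c ∂ν) *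
            R (V (t + 1)).1) (V t).2 (V (t + 1)).2
        ∂(Measure.pi fun _ => μ.prod Measure.count) := by
  rw [integral_prod _ (integrable_of_continuous  -- left: Fubini, then `integral_lhsIntegrand` slice by slice
    (continuous_lhsIntegrand K act Γ R w n hK hact hΓ hRc continuous_fst continuous_snd))]
  dsimp only
  simp_rw [integral_lhsIntegrand K act Γ R w ν n hK hact hΓ hRc hw]
  symm  -- right: split `(Fin N → X × F)` into `(Fin N → X) × (Fin N → F)`, Fubini, count the paths
  refine ((measurePreserving_arrowProdEquivProdArrow X F (Fin (n + 1)) (fun _ => μ)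
    (fun _ => (Measure.count : Measure F))).integral_comp' (fun q : (Fin (n + 1) → X) × (Fin (n + 1) → F) =>
      w (q.2 0) * ∏ t : Fin (n + 1), (R (q.1 t) *
        (Matrix.of fun a c => ∫ g, ((K (q.1 t) (act g (q.1 (t + 1))) : ℝ) : ℂ) * Γ g a c ∂ν) *
          R (q.1 (t + 1))) (q.2 t) (q.2 (t + 1)))).trans ?_
  rw [integral_prod _ (integrable_rhsIntegrand K act Γ R w ν μ n hK hact hΓ hRc)]
  simp only [integral_pi_count]

end Abstract

/-- The Fock-space gauge rotation `Γ(G_g) = fockGaugeAct g` depends continuously on the gauge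
transformation `g` (entries are fixed minors of the block-diagonal one-particle rotation). [folklore] -/
theorem continuous_fockGaugeAct {Nf S : ℕ} [NeZero S] :
    Continuous fun g : TorusSite 3 S → Matrix.specialUnitaryGroup (Fin 3) ℂ => fockGaugeAct (Nf := Nf) g := by
  have hrot : Continuous fun g : TorusSite 3 S → Matrix.specialUnitaryGroup (Fin 3) ℂ => sliceGaugeRot (Nf := Nf) g := by
    unfold sliceGaugeRot
    refine Sketch.FermionSliceContinuous.continuous_sliceKron (continuous_matrix fun p q => ?_) 1
    simp only [Matrix.of_apply]
    exact ((continuous_apply p.2.1).subtype_val.matrix_elem p.2.2 q.2.2).if_const _ continuous_const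
  unfold fockGaugeAct
  refine Sketch.FermionSliceContinuous.continuous_fockLift ?_
  simp only [Matrix.reindex_apply]
  exact hrot.matrix_submatrix _ _

end StubCyclicScalarise

/-- **Sub-goal B5 of E3 (registered stub `stub_cyclic_scalarise` of line `twisted_trace_transfer`): the
kernel-level cyclic (super)trace integrals of the capstones ARE cyclic integrals of the scalarised
kernel.**  For any continuous pointwise square root `R(U)² = T̂_F(U)` commuting with the fermion parity
`Π = diag((−1)^{#s})`, with the Gauss-averaged bond kernel `B(U,U')_{a c} = ∫ K_β(U, U'^g) Γ(G_g)_{a c} dg`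
and `k((U,s),(U',s')) = (R(U) B(U,U') R(U'))_{s s'}` on `SU(3)^{E₃} × Finset(modes)` (measure `Haar ⊗ count`):
`∫∫ ∏_t K_β(U_t, U_{t+1}^{g_t}) · Tr ∏_t T̂_F(U_t) Γ(G_{g_t}) dU dg = ∫ ∏_{t : Fin N} k(V t, V (t+1)) d(Haar ⊗ count)^{⊗N}(V)`,
and the same with the supertrace on the left and the insertion `(−1)^{#(V 0).2}` on the right
(`N = n + 1`, `ZMod (n+1) = Fin (n+1)`, `T̂_F = R R`, and `StubCyclicScalarise.main_fin` at `w = 1`,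
`w = (−1)^{#s}`). [cite: Luscher1977, pp. 283–292] [cite: MontvayMunster1994, §4.1.3 (4.34)] -/
theorem stub_cyclic_scalarise : ∀ (Nf N : ℕ) [NeZero N] (β : ℝ) (mq : Fin Nf → ℝ)
    (R : GaugeConfig 3 N (Matrix.specialUnitaryGroup (Fin 3) ℂ) → Matrix (Finset (SliceFermiIdx Nf N)) (Finset (SliceFermiIdx Nf N)) ℂ),
    Continuous R → (∀ U, R U * R U = fermionSliceOp U mq) →
    (∀ U, Matrix.diagonal (fun s : Finset (SliceFermiIdx Nf N) => (-1 : ℂ) ^ s.card) * R U =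
      R U * Matrix.diagonal (fun s : Finset (SliceFermiIdx Nf N) => (-1 : ℂ) ^ s.card)) →
    ((∫ p : (ZMod N → GaugeConfig 3 N (Matrix.specialUnitaryGroup (Fin 3) ℂ)) × (ZMod N → TorusSite 3 N → Matrix.specialUnitaryGroup (Fin 3) ℂ),
        ((∏ t : ZMod N, gaugeSliceKernel β (p.1 t) (gaugeTransform (p.2 t) (p.1 (t + 1))) : ℝ) : ℂ) *
          (((List.range N).map fun i : ℕ =>
              fermionSliceOp (p.1 (i : ZMod N)) mq * fockGaugeAct (Nf := Nf) (p.2 (i : ZMod N))).prod).trace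
        ∂((Measure.pi fun _ : ZMod N => Measure.pi fun _ : Edge 3 N => haarProbability (Matrix.specialUnitaryGroup (Fin 3) ℂ)).prod
            (Measure.pi fun _ : ZMod N => Measure.pi fun _ : TorusSite 3 N => haarProbability (Matrix.specialUnitaryGroup (Fin 3) ℂ)))) =
      ∫ V : Fin N → GaugeConfig 3 N (Matrix.specialUnitaryGroup (Fin 3) ℂ) × Finset (SliceFermiIdx Nf N),
        ∏ t : Fin N, (R (V t).1 * (Matrix.of fun a c => ∫ g : TorusSite 3 N → Matrix.specialUnitaryGroup (Fin 3) ℂ,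
            (gaugeSliceKernel β (V t).1 (gaugeTransform g (V (t + 1)).1) : ℂ) * fockGaugeAct (Nf := Nf) g a c
              ∂(Measure.pi fun _ => haarProbability (Matrix.specialUnitaryGroup (Fin 3) ℂ))) * R (V (t + 1)).1) (V t).2 (V (t + 1)).2
        ∂(Measure.pi fun _ => (sliceHaar N).prod Measure.count)) ∧
    ((∫ p : (ZMod N → GaugeConfig 3 N (Matrix.specialUnitaryGroup (Fin 3) ℂ)) × (ZMod N → TorusSite 3 N → Matrix.specialUnitaryGroup (Fin 3) ℂ),
        ((∏ t : ZMod N, gaugeSliceKernel β (p.1 t) (gaugeTransform (p.2 t) (p.1 (t + 1))) : ℝ) : ℂ) *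
          ∑ s : Finset (SliceFermiIdx Nf N), (-1 : ℂ) ^ s.card *
            (((List.range N).map fun i : ℕ =>
              fermionSliceOp (p.1 (i : ZMod N)) mq * fockGaugeAct (Nf := Nf) (p.2 (i : ZMod N))).prod) s s
        ∂((Measure.pi fun _ : ZMod N => Measure.pi fun _ : Edge 3 N => haarProbability (Matrix.specialUnitaryGroup (Fin 3) ℂ)).prod
            (Measure.pi fun _ : ZMod N => Measure.pi fun _ : TorusSite 3 N => haarProbability (Matrix.specialUnitaryGroup (Fin 3) ℂ)))) =
      ∫ V : Fin N → GaugeConfig 3 N (Matrix.specialUnitaryGroup (Fin 3) ℂ) × Finset (SliceFermiIdx Nf N),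
        (-1 : ℂ) ^ (V 0).2.card *
        ∏ t : Fin N, (R (V t).1 * (Matrix.of fun a c => ∫ g : TorusSite 3 N → Matrix.specialUnitaryGroup (Fin 3) ℂ,
            (gaugeSliceKernel β (V t).1 (gaugeTransform g (V (t + 1)).1) : ℂ) * fockGaugeAct (Nf := Nf) g a c
              ∂(Measure.pi fun _ => haarProbability (Matrix.specialUnitaryGroup (Fin 3) ℂ))) * R (V (t + 1)).1) (V t).2 (V (t + 1)).2
        ∂(Measure.pi fun _ => (sliceHaar N).prod Measure.count)) := by
  intro Nf N _ β mq R hRc hR2 hP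
  obtain ⟨n, rfl⟩ : ∃ n, N = n + 1 := ⟨N - 1, (Nat.succ_pred_eq_of_ne_zero (NeZero.ne N)).symm⟩
  simp only [StubCyclicScalarise.range_map_eq_ofFn, StubCyclicScalarise.natCast_zmod_fin, ← hR2]
  have key := fun (w : Finset (SliceFermiIdx Nf (n + 1)) → ℂ)
      (hw : ∀ U, Matrix.diagonal w * R U = R U * Matrix.diagonal w) =>
    StubCyclicScalarise.main_fin (gaugeSliceKernel β) gaugeTransform (fockGaugeAct (Nf := Nf)) R w
      (Measure.pi fun _ : TorusSite 3 (n + 1) => haarProbability (Matrix.specialUnitaryGroup (Fin 3) ℂ))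
      (Measure.pi fun _ : Edge 3 (n + 1) => haarProbability (Matrix.specialUnitaryGroup (Fin 3) ℂ)) n
      (Sketch.continuous_gaugeSliceKernel (n + 1) β) continuous_gaugeTransform_prod
      StubCyclicScalarise.continuous_fockGaugeAct hRc hw
  refine ⟨?_, key (fun s => (-1 : ℂ) ^ s.card) hP⟩
  have h := key (fun _ => 1) (fun U => by rw [Matrix.diagonal_one, Matrix.one_mul, Matrix.mul_one])
  simp only [one_mul] at h
  exact h

end Summit.QuantumFields.QCD.Cruxes.StableActionBridge.TwistedTraceTransfer

end
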